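import Summits.AtomisticToContinuum.HydrodynamicLimit.Theorems.BoltzmannGreenKubo.Negative.JointMeasurability

/-!
# The exponential anti-Mazur certificate (route AntiMazurCoboundaries, stmt-14137)

For a hard-sphere flow `Φ` on `𝕋³`, a `Φ`-invariant probability law `μ` not charging the bad set,
bounded measurable `F, W`, a window `h > 0` and a lag `lag > 0`:

  `∫ exp(h⁻¹ ∫₀ʰ F(Φ_s z) ds) dμ ≤ (∫ exp(2(F − lag⁻¹(W∘Φ_lag − W))) dμ)^½ · (∫ exp(4 h⁻¹ |W|) dμ)^½`.

Proof (folklore; the exponential form of the corrector trick of Varadhan's nongradient method,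
Kipnis–Landim 1999 Ch. 7 §2): with `D := lag⁻¹(W∘Φ_lag − W)`, `G := F − D`, pathwise telescoping
`h⁻¹∫₀ʰ F∘Φ_s = h⁻¹∫₀ʰ G∘Φ_s + B`, `B = h⁻¹ lag⁻¹ (∫_h^{h+lag} − ∫_0^{lag}) W∘Φ_u`; Cauchy–Schwarz
in `μ`; Jensen in time; Tonelli and invariance of `μ`; `e^{2B} ≤ ½ (e^{(4/h)avg₁} + e^{-(4/h)avg₂})`.
The argument is run for an abstract jointly measurable measure-preserving semigroup
`θ : ℝ × X → X` (`certificate_of_semigroup`) and transferred to `Φ.flow` through the modified flow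
`flowMod Φ` of `Theorems/BoltzmannGreenKubo/Negative/JointMeasurability.lean` (jointly measurable,
equal to the flow on the good set, a semigroup everywhere).
-/

noncomputable section

namespace Summit.AtomisticToContinuum.HydrodynamicLimit.Theorems

open MeasureTheory Set Filter intervalIntegral
open scoped ENNReal Interval
open Literature.Analysis.FluidPDE Literature.MathematicalPhysics.KineticTheory

namespace AntiMazurCoboundariesExponentialCertificate

section Abstract

variable {X : Type*} [MeasurableSpace X]

/-- A bounded measurable real function on `ℝ` is interval integrable on every interval. [folklore] -/
theorem intervalIntegrable_of_bounded {f : ℝ → ℝ} (hf : Measurable f) {C : ℝ}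
    (hC : ∀ s, |f s| ≤ C) (a b : ℝ) : IntervalIntegrable f volume a b :=
  (intervalIntegrable_const (c := C)).mono_fun' hf.aestronglyMeasurable
    (ae_of_all _ fun s => by simpa [Real.norm_eq_abs] using hC s)

/-- `exp` of a bounded measurable function is interval integrable on every interval. [folklore] -/
theorem intervalIntegrable_exp_of_bounded {g : ℝ → ℝ} (hg : Measurable g) {C : ℝ}
    (hC : ∀ s, |g s| ≤ C) (a b : ℝ) : IntervalIntegrable (fun s => Real.exp (g s)) volume a b := by
  refine intervalIntegrable_of_bounded hg.exp (C := Real.exp C) (fun s => ?_) a b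
  rw [abs_of_nonneg (Real.exp_nonneg _)]
  exact Real.exp_le_exp.2 ((le_abs_self _).trans (hC s))

/-- **Jensen in time** for the exponential: `exp` of a time average is at most the time average
of `exp`, for a bounded measurable integrand. [folklore] -/
theorem exp_average_le {g : ℝ → ℝ} (hg : Measurable g) {C : ℝ} (hC : ∀ s, |g s| ≤ C)
    {a b : ℝ} (hab : a < b) :
    Real.exp ((b - a)⁻¹ * ∫ s in a..b, g s) ≤ (b - a)⁻¹ * ∫ s in a..b, Real.exp (g s) := by
  have h1 := interval_average_eq g a b
  have h2 := interval_average_eq (fun s => Real.exp (g s)) a b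
  simp only [smul_eq_mul] at h1 h2
  rw [← h1, ← h2]
  have hvol : volume (Ι a b) = ENNReal.ofReal (b - a) := by
    rw [uIoc_of_le hab.le, Real.volume_Ioc]
  refine convexOn_exp.map_set_average_le Real.continuous_exp.continuousOn isClosed_univ ?_ ?_
    (ae_of_all _ fun _ => mem_univ _) (intervalIntegrable_of_bounded hg hC a b).def'
    (intervalIntegrable_exp_of_bounded hg hC a b).def'
  · rw [hvol]
    exact (ENNReal.ofReal_pos.2 (sub_pos.2 hab)).ne'
  · rw [hvol]
    exact ENNReal.ofReal_ne_top

/-- `e^x e^y ≤ ½ (e^{2x} + e^{2y})`. [folklore] -/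
theorem exp_add_le_half (x y : ℝ) :
    Real.exp (x + y) ≤ (Real.exp (2 * x) + Real.exp (2 * y)) / 2 := by
  have h := two_mul_le_add_sq (Real.exp x) (Real.exp y)
  rw [Real.exp_add, two_mul, Real.exp_add, two_mul, Real.exp_add, ← sq, ← sq]
  linarith

variable (θ : ℝ × X → X)

/-- Window integrals along a jointly measurable map are measurable in the initial datum. [folklore] -/
theorem measurable_intervalIntegral_comp (hθ : Measurable θ) {H : X → ℝ} (hH : Measurable H)
    {a b : ℝ} (hab : a ≤ b) : Measurable fun z => ∫ s in a..b, H (θ (s, z)) := by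
  simp only [intervalIntegral.integral_of_le hab]
  have hsm : StronglyMeasurable fun p : ℝ × X => H (θ p) := (hH.comp hθ).stronglyMeasurable
  exact (hsm.integral_prod_left' (μ := volume.restrict (Ioc a b))).measurable

/-- **Tonelli + invariance**: the `μ`-integral of a window integral of a nonnegative bounded
observable along a `μ`-preserving jointly measurable map is the window length times the
`μ`-integral of the observable. [folklore] -/
theorem lintegral_ofReal_intervalIntegral_comp (hθ : Measurable θ) (μ : Measure X) [SFinite μ]
    (hinv : ∀ t, MeasurePreserving (fun z => θ (t, z)) μ μ) {E : X → ℝ} (hE : Measurable E)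
    (hE0 : ∀ z, 0 ≤ E z) {C : ℝ} (hC : ∀ z, |E z| ≤ C) {a b : ℝ} (hab : a ≤ b) :
    ∫⁻ z, ENNReal.ofReal (∫ s in a..b, E (θ (s, z))) ∂μ =
      ENNReal.ofReal (b - a) * ∫⁻ z, ENNReal.ofReal (E z) ∂μ := by
  have step1 : ∀ z, ENNReal.ofReal (∫ s in a..b, E (θ (s, z))) =
      ∫⁻ s in Ioc a b, ENNReal.ofReal (E (θ (s, z))) := by
    intro z
    rw [intervalIntegral.integral_of_le hab]
    refine ofReal_integral_eq_lintegral_ofReal ?_ (ae_of_all _ fun s => hE0 _)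
    have hm : Measurable fun s : ℝ => E (θ (s, z)) := hE.comp (hθ.comp measurable_prodMk_right)
    exact (intervalIntegrable_of_bounded hm (fun s => hC _) a b).1
  simp only [step1]
  have hm2 : Measurable (Function.uncurry fun (z : X) (s : ℝ) => ENNReal.ofReal (E (θ (s, z)))) :=
    ENNReal.measurable_ofReal.comp (hE.comp (hθ.comp measurable_swap))
  rw [lintegral_lintegral_swap (μ := μ) (ν := volume.restrict (Ioc a b)) hm2.aemeasurable]
  have step2 : ∀ s, ∫⁻ z, ENNReal.ofReal (E (θ (s, z))) ∂μ = ∫⁻ z, ENNReal.ofReal (E z) ∂μ :=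
    fun s => (hinv s).lintegral_comp (ENNReal.measurable_ofReal.comp hE)
  simp only [step2]
  rw [setLIntegral_const, Real.volume_Ioc, mul_comm]

/-- **The exponential certificate for an abstract jointly measurable measure-preserving semigroup**
`θ : ℝ × X → X`: for bounded measurable `F, W`, `h > 0`, `lag > 0`,
`∫ exp(h⁻¹∫₀ʰ F(θ_s z) ds) dμ ≤ (∫ exp(2(F − lag⁻¹(W∘θ_lag − W))) dμ)^½ (∫ exp(4h⁻¹|W|) dμ)^½`.
Telescoping + Cauchy–Schwarz + Jensen in time + Tonelli/invariance + AM–GM. [folklore] -/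
theorem certificate_of_semigroup (hθ : Measurable θ)
    (hsg : ∀ s t z, θ (s + t, z) = θ (s, θ (t, z))) (μ : Measure X) [SFinite μ]
    (hinv : ∀ t, MeasurePreserving (fun z => θ (t, z)) μ μ) {F W : X → ℝ} (hF : Measurable F)
    (hW : Measurable W) {CF CW : ℝ} (hCF : ∀ z, |F z| ≤ CF) (hCW : ∀ z, |W z| ≤ CW)
    {h lag : ℝ} (hh : 0 < h) (hlag : 0 < lag) :
    ∫⁻ z, ENNReal.ofReal (Real.exp (h⁻¹ * ∫ s in (0 : ℝ)..h, F (θ (s, z)))) ∂μ ≤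
      (∫⁻ z, ENNReal.ofReal (Real.exp (2 * (F z - lag⁻¹ * (W (θ (lag, z)) - W z)))) ∂μ) ^
          (1 / 2 : ℝ) *
        (∫⁻ z, ENNReal.ofReal (Real.exp (4 * h⁻¹ * |W z|)) ∂μ) ^ (1 / 2 : ℝ) := by
  -- the corrector derivative `D`, the corrected observable `G`
  set D : X → ℝ := fun z => lag⁻¹ * (W (θ (lag, z)) - W z) with hD
  set G : X → ℝ := fun z => F z - D z with hG
  have hθs : ∀ z, Measurable fun s : ℝ => θ (s, z) := fun z => hθ.comp measurable_prodMk_right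
  have hDm : Measurable D := ((hW.comp (hθ.comp measurable_prodMk_left)).sub hW).const_mul _
  have hGm : Measurable G := hF.sub hDm
  have hWs : ∀ z, Measurable fun s => W (θ (s, z)) := fun z => hW.comp (hθs z)
  have hGs : ∀ z, Measurable fun s => G (θ (s, z)) := fun z => hGm.comp (hθs z)
  have hDb : ∀ z, |D z| ≤ lag⁻¹ * (CW + CW) := fun z => by
    rw [hD, abs_mul, abs_of_pos (inv_pos.2 hlag)]
    exact mul_le_mul_of_nonneg_left ((abs_sub _ _).trans (add_le_add (hCW _) (hCW _)))
      (inv_pos.2 hlag).le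
  have hGb : ∀ z, |G z| ≤ CF + lag⁻¹ * (CW + CW) := fun z =>
    (abs_sub (F z) (D z)).trans (add_le_add (hCF z) (hDb z))
  have hG2b : ∀ z, |2 * G z| ≤ 2 * (CF + lag⁻¹ * (CW + CW)) := fun z => by
    rw [abs_mul, abs_two]
    exact mul_le_mul_of_nonneg_left (hGb z) zero_le_two
  have c_nonneg : 0 ≤ 4 * h⁻¹ := by positivity
  -- the window integrals `P, Q`, the corrected average `a` and the boundary term `B`
  obtain ⟨P, hP⟩ : ∃ P : X → ℝ, P = fun z => ∫ u in h..h + lag, W (θ (u, z)) := ⟨_, rfl⟩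
  obtain ⟨Q, hQ⟩ : ∃ Q : X → ℝ, Q = fun z => ∫ u in (0 : ℝ)..lag, W (θ (u, z)) := ⟨_, rfl⟩
  obtain ⟨a, ha⟩ : ∃ a : X → ℝ, a = fun z => h⁻¹ * ∫ s in (0 : ℝ)..h, G (θ (s, z)) := ⟨_, rfl⟩
  obtain ⟨B, hB⟩ : ∃ B : X → ℝ, B = fun z => h⁻¹ * lag⁻¹ * (P z - Q z) := ⟨_, rfl⟩
  -- orbit integrability
  have hWorb : ∀ z (a' b' : ℝ), IntervalIntegrable (fun u => W (θ (u, z))) volume a' b' :=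
    fun z a' b' => intervalIntegrable_of_bounded (hW.comp (hθs z)) (fun u => hCW _) a' b'
  have hGorb : ∀ z, IntervalIntegrable (fun s => G (θ (s, z))) volume 0 h := fun z =>
    intervalIntegrable_of_bounded (hGm.comp (hθs z)) (fun s => hGb _) 0 h
  have hDorb : ∀ z, IntervalIntegrable (fun s => D (θ (s, z))) volume 0 h := fun z =>
    intervalIntegrable_of_bounded (hDm.comp (hθs z)) (fun s => hDb _) 0 h
  -- Step 1: pathwise telescoping
  have step1 : ∀ z, h⁻¹ * ∫ s in (0 : ℝ)..h, F (θ (s, z)) = a z + B z := by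
    intro z
    have e1 : ∫ s in (0 : ℝ)..h, F (θ (s, z)) =
        (∫ s in (0 : ℝ)..h, G (θ (s, z))) + ∫ s in (0 : ℝ)..h, D (θ (s, z)) := by
      rw [← intervalIntegral.integral_add (hGorb z) (hDorb z)]
      refine intervalIntegral.integral_congr fun s _ => ?_
      simp only [hG, sub_add_cancel]
    have e2 : ∫ s in (0 : ℝ)..h, D (θ (s, z)) =
        lag⁻¹ * ((∫ u in lag..lag + h, W (θ (u, z))) - ∫ u in (0 : ℝ)..h, W (θ (u, z))) := by
      have hrw : ∀ s, D (θ (s, z)) = lag⁻¹ * (W (θ (lag + s, z)) - W (θ (s, z))) := fun s => by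
        rw [hsg]
      simp only [hrw]
      have hWorb' : IntervalIntegrable (fun s => W (θ (lag + s, z))) volume 0 h := by
        refine intervalIntegrable_of_bounded (hW.comp (hθ.comp ?_)) (fun s => hCW _) 0 h
        exact (measurable_const.add measurable_id).prodMk measurable_const
      rw [intervalIntegral.integral_const_mul, intervalIntegral.integral_sub hWorb' (hWorb z 0 h),
        intervalIntegral.integral_comp_add_left (fun u => W (θ (u, z))) lag, add_zero]
    have e3 : (∫ u in lag..lag + h, W (θ (u, z))) - ∫ u in (0 : ℝ)..h, W (θ (u, z)) =
        P z - Q z := by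
      rw [hP, hQ, intervalIntegral.integral_interval_sub_interval_comm' (hWorb z _ _) (hWorb z _ _)
        (hWorb z _ _), add_comm lag h]
    rw [e1, e2, e3, ha, hB]
    ring
  -- Step 2: measurability of `a` and `B`
  have ham : Measurable a := ha ▸ (measurable_intervalIntegral_comp θ hθ hGm hh.le).const_mul _
  have hPm : Measurable P :=
    hP ▸ measurable_intervalIntegral_comp θ hθ hW (by linarith : h ≤ h + lag)
  have hQm : Measurable Q := hQ ▸ measurable_intervalIntegral_comp θ hθ hW hlag.le
  have hBm : Measurable B := hB ▸ (hPm.sub hQm).const_mul _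
  -- Step 3: Cauchy–Schwarz
  have hfm : AEMeasurable (fun z => ENNReal.ofReal (Real.exp (a z))) μ :=
    (ENNReal.measurable_ofReal.comp ham.exp).aemeasurable
  have hgm : AEMeasurable (fun z => ENNReal.ofReal (Real.exp (B z))) μ :=
    (ENNReal.measurable_ofReal.comp hBm.exp).aemeasurable
  have hsq : ∀ x : ℝ, ENNReal.ofReal (Real.exp x) ^ (2 : ℝ) = ENNReal.ofReal (Real.exp (2 * x)) :=
    fun x => by rw [ENNReal.rpow_two, ← ENNReal.ofReal_pow (Real.exp_nonneg _), two_mul,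
      Real.exp_add, sq]
  have holder := ENNReal.lintegral_mul_le_Lp_mul_Lq μ Real.HolderConjugate.two_two hfm hgm
  simp only [Pi.mul_apply, hsq] at holder
  have lhs_eq : ∫⁻ z, ENNReal.ofReal (Real.exp (h⁻¹ * ∫ s in (0 : ℝ)..h, F (θ (s, z)))) ∂μ =
      ∫⁻ z, ENNReal.ofReal (Real.exp (a z)) * ENNReal.ofReal (Real.exp (B z)) ∂μ := by
    refine lintegral_congr fun z => ?_
    rw [step1 z, Real.exp_add, ENNReal.ofReal_mul (Real.exp_nonneg _)]
  -- Step 4a: the corrected factor — Jensen in time, Tonelli, invariance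
  have fac1 : ∫⁻ z, ENNReal.ofReal (Real.exp (2 * a z)) ∂μ ≤
      ∫⁻ z, ENNReal.ofReal (Real.exp (2 * G z)) ∂μ := by
    have pt : ∀ z, Real.exp (2 * a z) ≤ h⁻¹ * ∫ s in (0 : ℝ)..h, Real.exp (2 * G (θ (s, z))) := by
      intro z
      have hj := exp_average_le ((hGs z).const_mul 2) (fun s => hG2b (θ (s, z))) hh
      rw [sub_zero] at hj
      refine le_of_eq_of_le ?_ hj
      rw [ha, intervalIntegral.integral_const_mul]
      congr 1
      ring
    have hE2m : Measurable fun x => Real.exp (2 * G x) := (hGm.const_mul 2).exp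
    have hE2b : ∀ x, |Real.exp (2 * G x)| ≤ Real.exp (2 * (CF + lag⁻¹ * (CW + CW))) := fun x => by
      rw [abs_of_nonneg (Real.exp_nonneg _)]
      exact Real.exp_le_exp.2 ((le_abs_self _).trans (hG2b x))
    calc ∫⁻ z, ENNReal.ofReal (Real.exp (2 * a z)) ∂μ
        ≤ ∫⁻ z, ENNReal.ofReal (h⁻¹ * ∫ s in (0 : ℝ)..h, Real.exp (2 * G (θ (s, z)))) ∂μ :=
          lintegral_mono fun z => ENNReal.ofReal_le_ofReal (pt z)
      _ = ENNReal.ofReal h⁻¹ *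
            ∫⁻ z, ENNReal.ofReal (∫ s in (0 : ℝ)..h, Real.exp (2 * G (θ (s, z)))) ∂μ := by
          have hm : Measurable fun z =>
              ENNReal.ofReal (∫ s in (0 : ℝ)..h, Real.exp (2 * G (θ (s, z)))) :=
            ENNReal.measurable_ofReal.comp (measurable_intervalIntegral_comp θ hθ hE2m hh.le)
          rw [← lintegral_const_mul _ hm]
          exact lintegral_congr fun z => by rw [ENNReal.ofReal_mul (inv_pos.2 hh).le]
      _ = ENNReal.ofReal h⁻¹ * (ENNReal.ofReal (h - 0) *
            ∫⁻ z, ENNReal.ofReal (Real.exp (2 * G z)) ∂μ) := by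
          rw [lintegral_ofReal_intervalIntegral_comp θ hθ μ hinv hE2m (fun z => Real.exp_nonneg _)
            hE2b hh.le]
      _ = ∫⁻ z, ENNReal.ofReal (Real.exp (2 * G z)) ∂μ := by
          rw [sub_zero, ← mul_assoc, ← ENNReal.ofReal_mul (inv_pos.2 hh).le,
            inv_mul_cancel₀ hh.ne', ENNReal.ofReal_one, one_mul]
  -- Step 4b: the boundary factor — AM–GM, Jensen in time twice, Tonelli, invariance
  have fac2 : ∫⁻ z, ENNReal.ofReal (Real.exp (2 * B z)) ∂μ ≤
      ∫⁻ z, ENNReal.ofReal (Real.exp (4 * h⁻¹ * |W z|)) ∂μ := by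
    obtain ⟨E, hE⟩ : ∃ E : X → ℝ, E = fun x => Real.exp (4 * h⁻¹ * |W x|) := ⟨_, rfl⟩
    have hEm : Measurable E := by
      rw [hE]
      exact (hW.abs.const_mul (4 * h⁻¹)).exp
    have hE0 : ∀ x, 0 ≤ E x := fun x => by
      rw [hE]
      exact Real.exp_nonneg _
    have hEb : ∀ x, |E x| ≤ Real.exp (4 * h⁻¹ * CW) := fun x => by
      rw [abs_of_nonneg (hE0 x), hE]
      exact Real.exp_le_exp.2 (mul_le_mul_of_nonneg_left (hCW x) c_nonneg)
    have hEorb : ∀ z (a' b' : ℝ), IntervalIntegrable (fun u => E (θ (u, z))) volume a' b' :=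
      fun z a' b' => intervalIntegrable_of_bounded (hEm.comp (hθs z)) (fun u => hEb _) a' b'
    have pt : ∀ z, Real.exp (2 * B z) ≤
        (lag⁻¹ * (∫ u in h..h + lag, E (θ (u, z))) + lag⁻¹ * ∫ u in (0 : ℝ)..lag, E (θ (u, z))) / 2 := by
      intro z
      have e0 : 2 * B z = 2 * h⁻¹ * lag⁻¹ * P z + -(2 * h⁻¹ * lag⁻¹ * Q z) := by
        rw [hB]
        ring
      rw [e0]
      refine (exp_add_le_half _ _).trans ?_
      gcongr (?_ + ?_) / 2
      · -- the forward window `[h, h + lag]`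
        have hbd : ∀ u, |4 * h⁻¹ * W (θ (u, z))| ≤ 4 * h⁻¹ * CW := fun u => by
          rw [abs_mul, abs_of_nonneg c_nonneg]
          exact mul_le_mul_of_nonneg_left (hCW _) c_nonneg
        have hj := exp_average_le ((hWs z).const_mul (4 * h⁻¹)) hbd (by linarith : h < h + lag)
        rw [add_sub_cancel_left] at hj
        refine (le_of_eq ?_).trans (hj.trans ?_)
        · rw [hP, intervalIntegral.integral_const_mul]
          congr 1
          ring
        · refine mul_le_mul_of_nonneg_left ?_ (inv_pos.2 hlag).le
          refine intervalIntegral.integral_mono_on (by linarith)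
            (intervalIntegrable_exp_of_bounded ((hWs z).const_mul (4 * h⁻¹)) hbd _ _)
            (hEorb z _ _) fun u _ => ?_
          rw [hE]
          exact Real.exp_le_exp.2 (mul_le_mul_of_nonneg_left (le_abs_self _) c_nonneg)
      · -- the initial window `[0, lag]`
        have hbd : ∀ u, |-(4 * h⁻¹) * W (θ (u, z))| ≤ 4 * h⁻¹ * CW := fun u => by
          rw [abs_mul, abs_neg, abs_of_nonneg c_nonneg]
          exact mul_le_mul_of_nonneg_left (hCW _) c_nonneg
        have hj := exp_average_le ((hWs z).const_mul (-(4 * h⁻¹))) hbd hlag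
        rw [sub_zero] at hj
        refine (le_of_eq ?_).trans (hj.trans ?_)
        · rw [hQ, intervalIntegral.integral_const_mul]
          congr 1
          ring
        · refine mul_le_mul_of_nonneg_left ?_ (inv_pos.2 hlag).le
          refine intervalIntegral.integral_mono_on hlag.le
            (intervalIntegrable_exp_of_bounded ((hWs z).const_mul (-(4 * h⁻¹))) hbd _ _)
            (hEorb z _ _) fun u _ => ?_
          rw [hE, neg_mul, ← mul_neg]
          exact Real.exp_le_exp.2 (mul_le_mul_of_nonneg_left (neg_le_abs _) c_nonneg)
    have hIP : ∀ z, 0 ≤ ∫ u in h..h + lag, E (θ (u, z)) := fun z =>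
      intervalIntegral.integral_nonneg (by linarith) fun u _ => hE0 _
    have hIQ : ∀ z, 0 ≤ ∫ u in (0 : ℝ)..lag, E (θ (u, z)) := fun z =>
      intervalIntegral.integral_nonneg hlag.le fun u _ => hE0 _
    have hIPm : Measurable fun z => ENNReal.ofReal (∫ u in h..h + lag, E (θ (u, z))) :=
      ENNReal.measurable_ofReal.comp (measurable_intervalIntegral_comp θ hθ hEm (by linarith))
    have hIQm : Measurable fun z => ENNReal.ofReal (∫ u in (0 : ℝ)..lag, E (θ (u, z))) :=
      ENNReal.measurable_ofReal.comp (measurable_intervalIntegral_comp θ hθ hEm hlag.le)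
    have key : ENNReal.ofReal (lag⁻¹ / 2) * ENNReal.ofReal (lag + lag) = 1 := by
      rw [← ENNReal.ofReal_mul (by positivity), ← ENNReal.ofReal_one]
      congr 1
      rw [div_mul_eq_mul_div, mul_add, inv_mul_cancel₀ hlag.ne']
      norm_num
    calc ∫⁻ z, ENNReal.ofReal (Real.exp (2 * B z)) ∂μ
        ≤ ∫⁻ z, ENNReal.ofReal ((lag⁻¹ * (∫ u in h..h + lag, E (θ (u, z))) +
            lag⁻¹ * ∫ u in (0 : ℝ)..lag, E (θ (u, z))) / 2) ∂μ :=
          lintegral_mono fun z => ENNReal.ofReal_le_ofReal (pt z)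
      _ = ∫⁻ z, ENNReal.ofReal (lag⁻¹ / 2) * (ENNReal.ofReal (∫ u in h..h + lag, E (θ (u, z))) +
            ENNReal.ofReal (∫ u in (0 : ℝ)..lag, E (θ (u, z)))) ∂μ := by
          refine lintegral_congr fun z => ?_
          rw [← ENNReal.ofReal_add (hIP z) (hIQ z), ← ENNReal.ofReal_mul (by positivity)]
          congr 1
          ring
      _ = ENNReal.ofReal (lag⁻¹ / 2) * (∫⁻ z, ENNReal.ofReal (∫ u in h..h + lag, E (θ (u, z))) ∂μ +
            ∫⁻ z, ENNReal.ofReal (∫ u in (0 : ℝ)..lag, E (θ (u, z))) ∂μ) := by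
          have e := lintegral_const_mul (μ := μ) (ENNReal.ofReal (lag⁻¹ / 2)) (hIPm.fun_add hIQm)
          rw [lintegral_add_left hIPm] at e
          exact e
      _ = ENNReal.ofReal (lag⁻¹ / 2) * (ENNReal.ofReal (h + lag - h) * ∫⁻ z, ENNReal.ofReal (E z) ∂μ +
            ENNReal.ofReal (lag - 0) * ∫⁻ z, ENNReal.ofReal (E z) ∂μ) := by
          rw [lintegral_ofReal_intervalIntegral_comp θ hθ μ hinv hEm hE0 hEb (by linarith),
            lintegral_ofReal_intervalIntegral_comp θ hθ μ hinv hEm hE0 hEb hlag.le]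
      _ = ∫⁻ z, ENNReal.ofReal (E z) ∂μ := by
          rw [add_sub_cancel_left, sub_zero, ← add_mul, ← ENNReal.ofReal_add hlag.le hlag.le,
            ← mul_assoc, key, one_mul]
      _ = ∫⁻ z, ENNReal.ofReal (Real.exp (4 * h⁻¹ * |W z|)) ∂μ := by rw [hE]
  -- Step 5: assemble
  calc ∫⁻ z, ENNReal.ofReal (Real.exp (h⁻¹ * ∫ s in (0 : ℝ)..h, F (θ (s, z)))) ∂μ
      = ∫⁻ z, ENNReal.ofReal (Real.exp (a z)) * ENNReal.ofReal (Real.exp (B z)) ∂μ := lhs_eq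
    _ ≤ (∫⁻ z, ENNReal.ofReal (Real.exp (2 * a z)) ∂μ) ^ (1 / 2 : ℝ) *
          (∫⁻ z, ENNReal.ofReal (Real.exp (2 * B z)) ∂μ) ^ (1 / 2 : ℝ) := holder
    _ ≤ (∫⁻ z, ENNReal.ofReal (Real.exp (2 * G z)) ∂μ) ^ (1 / 2 : ℝ) *
          (∫⁻ z, ENNReal.ofReal (Real.exp (4 * h⁻¹ * |W z|)) ∂μ) ^ (1 / 2 : ℝ) :=
        mul_le_mul' (ENNReal.rpow_le_rpow fac1 (by norm_num)) (ENNReal.rpow_le_rpow fac2 (by norm_num))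

end Abstract

section Transfer

open BoltzmannGreenKuboOrthMomentum

variable {N : ℕ} {ε : ℝ}

/-- The flow modified off the good set is a semigroup EVERYWHERE (the group law of the flow on the
invariant good set; the identity in time off it). [folklore] -/
theorem flowMod_add (Φ : HardSphereFlow (Torus.geometry (Fin 3)) ε N) (s t : ℝ)
    (z : Config N (Fin 3) T3) :
    flowMod Φ (s + t, z) = flowMod Φ (s, flowMod Φ (t, z)) := by
  by_cases hz : z ∈ Φ.good
  · rw [flowMod_of_mem Φ hz, flowMod_of_mem Φ hz, flowMod_of_mem Φ (Φ.mapsTo_good t hz),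
      Φ.flow_add s t z hz]
  · simp [flowMod, hz]

/-- Each time slice of the modified flow preserves every flow-invariant law that does not charge
the bad set. [folklore] -/
theorem measurePreserving_flowMod (Φ : HardSphereFlow (Torus.geometry (Fin 3)) ε N)
    (μ : Measure (Config N (Fin 3) T3)) (hinv : ∀ t, MeasurePreserving (Φ.flow t) μ μ)
    (hgood : μ Φ.goodᶜ = 0) (t : ℝ) :
    MeasurePreserving (fun z => flowMod Φ (t, z)) μ μ := by
  have hm : Measurable fun z => flowMod Φ (t, z) :=
    (measurable_flowMod Φ).comp measurable_prodMk_left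
  have hae : (fun z => flowMod Φ (t, z)) =ᵐ[μ] Φ.flow t := by
    filter_upwards [(mem_ae_iff.2 hgood : Φ.good ∈ ae μ)] with z hz
    exact flowMod_of_mem Φ hz
  exact ⟨hm, by rw [Measure.map_congr hae, (hinv t).map_eq]⟩

end Transfer

end AntiMazurCoboundariesExponentialCertificate

open AntiMazurCoboundariesExponentialCertificate BoltzmannGreenKuboOrthMomentum in
/-- **The exponential anti-Mazur certificate** (route `AntiMazurCoboundaries`, item
stmt-AtomisticToContinuum-14137): for any hard-sphere flow `Φ` on `𝕋³`, any `Φ`-invariant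
probability law `μ` with `μ(goodᶜ) = 0`, bounded measurable `F, W`, window `h > 0` and `lag > 0`,
`∫ exp(h⁻¹∫₀ʰ F(Φ_s z) ds) dμ ≤ (∫ exp(2(F − lag⁻¹(W∘Φ_lag − W))) dμ)^½ · (∫ exp(4h⁻¹|W|) dμ)^½`.
The abstract certificate `certificate_of_semigroup` applied to the modified flow `flowMod Φ`
(jointly measurable, a semigroup everywhere, `μ`-preserving), transferred to `Φ.flow` along
`μ(goodᶜ) = 0`. [folklore] -/
theorem exponentialCertificate_proof :
    Summit.AtomisticToContinuum.HydrodynamicLimit.Theses.AntiMazurCoboundaries.ExponentialCertificate := by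
  intro ε N Φ μ _ hinv hgood F W hF hW hFb hWb h lag hh hlag
  obtain ⟨CF, hCF⟩ := hFb
  obtain ⟨CW, hCW⟩ := hWb
  have hae : ∀ᵐ z ∂μ, z ∈ Φ.good := (mem_ae_iff.2 hgood : Φ.good ∈ ae μ)
  have core := certificate_of_semigroup (flowMod Φ) (measurable_flowMod Φ) (flowMod_add Φ) μ
    (measurePreserving_flowMod Φ μ hinv hgood) hF hW hCF hCW hh hlag
  have lhs : ∫⁻ z, ENNReal.ofReal (Real.exp (h⁻¹ * ∫ s in (0 : ℝ)..h, F (Φ.flow s z))) ∂μ =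
      ∫⁻ z, ENNReal.ofReal (Real.exp (h⁻¹ * ∫ s in (0 : ℝ)..h, F (flowMod Φ (s, z)))) ∂μ := by
    refine lintegral_congr_ae ?_
    filter_upwards [hae] with z hz
    simp only [flowMod_of_mem Φ hz]
  have rhs : ∫⁻ z, ENNReal.ofReal (Real.exp (2 * (F z - lag⁻¹ * (W (Φ.flow lag z) - W z)))) ∂μ =
      ∫⁻ z, ENNReal.ofReal (Real.exp (2 * (F z - lag⁻¹ * (W (flowMod Φ (lag, z)) - W z)))) ∂μ := by
    refine lintegral_congr_ae ?_
    filter_upwards [hae] with z hz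
    rw [flowMod_of_mem Φ hz]
  rw [lhs, rhs]
  exact core

end Summit.AtomisticToContinuum.HydrodynamicLimit.Theorems

end
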